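import Summits.CriticalPhenomena.PercolationContinuityZ3.Theorems.FK.Transplant.FreeBoundaryHypothesesKN
import Summits.CriticalPhenomena.PercolationContinuityZ3.Theorems.FK.Transplant.KNFreeLawSupport
import Summits.CriticalPhenomena.PercolationContinuityZ3.Theorems.FK.Transplant.KNFreeLawTranslate
import HarnessLib

/-!
# FK-continuity transplant, row 5 (`h_orig`): Kozma–Nitzan's (32) at the origin from ONE free look — the binder
# `KNFreeOriginLook` discharged

Cell `fk-continuity` (bschramm), FRONTIER TRANSPLANT sub-cell, BINDER-OWNERS row 5 (`h_orig`, owner fkt-p3); support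
file (`--supports stmt-CriticalPhenomena-4575`); builds on p205010 (kernel theorem, internal audit signed; external
expert review pending). HONEST FRAMING: the transplant `ufsc0_of_freeBoundaryHypothesis_r0` this file serves is
CONDITIONAL on the free-boundary penetration hypothesis FH (open at the same `p` for `q > 1`; ⇔ GRC Conj. (5.103) via
the referee's calibration K1; barrier note `Literature.Barriers.CriticalPhenomena.SamePFreeBoundaryCriteria`, theorem
`samePFreeBoundaryCriteria`, p243859); it is a typed reduction, not a proof of FK continuity. THIS file DISCHARGES the
PROVE binder `KNFreeOriginLook d q p` (FT-01b `FreeBoundaryHypothesesKN.lean`) for every `d`, every `p` and every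
`q ≥ 1` — unconditionally (no `FH`, no named fact, no sorry, standard axioms).

## The statement and its proof

`KNFreeOriginLook d q p`: for every KN examination scheme `S` at parameter `p` and every direction `du`, the free look
`FKLookAt q p g S.δc (3r) (3r)` of the aspect-`6` elongated geometry `g` of direction `du` (box `3r·Q_g`, seed
`Λ_{3r}` wired, lattice `p` inside, nothing outside; KN p. 28 "our definition of `m₂`") implies (32)-FK at the origin
(`OriginFK S q du`): under the law `fkLaw (Q_0 ∪ E_{0,v}) W q` of the origin weighting `W` (lattice `p` on the pairs
inside `Q_0 ∪ E_{0,v}`, the edges `U₀` of `Q_0` pinned open) `0` is joined to `M_v` inside `Q_0 ∪ E_{0,v}` with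
probability `> 1 - δ`. This is the tree's `q = 1` proof `KSch.hQ0_of_hit` (LP/KozmaNitzanTheorem6.lean) with the law
swapped: (i) the look's box `3r·Q_g` lies inside `Q_0 ∪ E_{0,v}` and its face inside `M_v` (tree geometry, verbatim);
(ii) Λ-INDEPENDENCE (`fkLaw_eq_of_subset`, FT-05a): the free look read on `Q_0 ∪ E_{0,v}` has the same law;
(iii) MONOTONICITY in the weighting (Grimmett 2006 (3.22), `fkLaw_real_mono_weights'`): `hitW ≤ W` pointwise — inside
the look's box `W` is lattice `p` or `1`, and the seed edges (inside `Λ_{3r} ⊆ Q_0`) are pinned to `1` in both;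
(iv) `U₀` is open ALMOST SURELY under the pinned law (`fkLaw_real_inter_setOf_subset_eq`) — where KN (and the tree at
`q = 1`) say "positively correlated with the event that all edges of `Q_{(0,0)}` are open", the pinned FK law makes it
an almost-sure statement; (v) the event inclusion of the tree proof: an open `U₀` joins `0` to the seed inside `Q_0`,
and the look's link continues to `3r·F_g ⊆ M_v` inside `Q_0 ∪ E_{0,v}`.

## References

* G. Kozma, S. Nitzan, arXiv:2401.12397 (2024), §4 p. 28 ((32) for `w = 0`). [KozmaNitzan2024]
* G. Grimmett, *The Random-Cluster Model*, Springer 2006: Thm. (3.21), eq. (3.22); Thm. (3.7). [Grimmett2006]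
-/

noncomputable section

open MeasureTheory Finset SimpleGraph
open scoped ENNReal Classical

namespace Summit.CriticalPhenomena.PercolationContinuityZ3.Theorems.FK

open Literature.Probability.Percolation Literature.Probability.LatticeModels
open Literature.Probability.Percolation.GadgetSystem Literature.Probability.Percolation.KozmaNitzan
open Literature.Probability.Percolation.KozmaNitzan.Cells

variable {d : ℕ}

/-- **The origin weighting dominates the free-look weighting of the aspect-`6` look** (KN p. 28): inside the box
`3r·Q_g ⊆ Q_0 ∪ E_{0,v}` the origin weighting is lattice `p` or `1` (on `U₀`), the seed edges of `Λ_{3r} ⊆ Q_0` lie in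
`U₀`, and off the box the free-look weighting vanishes. [cite: KozmaNitzan2024, §4 p. 28 ((32) for w = 0)] -/
theorem hitW_le_originW (S : KSch d) {Λ₀ Λ : Finset (Site d)} (hΛ : Λ₀ ⊆ Λ) {m : ℕ}
    (hball : GM.ball (0 : Site d) m ⊆ S.C.Q 0) (g : Geom d) (ℓ : ℕ) (hQ : g.Qset ℓ 0 = Λ₀) :
    hitW S.p g ℓ m 0 ≤ restrW (↑Λ : Set (Site d)) (pinW (lattW d S.p) ↑S.U₀ ↑S.U₀) := by
  intro e
  unfold hitW
  rw [hQ]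
  by_cases he : e ∈ wireSet (↑Λ₀ : Set (Site d))
  · have he' : e ∈ wireSet (↑Λ : Set (Site d)) := wireSet_mono (Finset.coe_subset.2 hΛ) he
    rw [restrW_apply_of_mem _ he, restrW_apply_of_mem _ he', pinW_apply, pinW_apply]
    by_cases hE : e ∈ (↑(edgesIn (zdGraph d) (GM.ball (0 : Site d) m)) : Set (Sym2 (Site d)))
    · -- a seed edge: pinned to `1` on both sides (`Λ_m ⊆ Q_0`, so it lies in `U₀`)
      have hU : e ∈ (↑S.U₀ : Set (Sym2 (Site d))) := by
        rw [Finset.mem_coe, KSch.U₀, mem_edgesIn_iff]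
        rw [Finset.mem_coe, mem_edgesIn_iff] at hE
        exact ⟨hE.1, fun x hx => hball (hE.2 x hx)⟩
      rw [if_pos hE, if_pos hE, if_pos hU, if_pos hU]
    · rw [if_neg hE]
      by_cases hU : e ∈ (↑S.U₀ : Set (Sym2 (Site d)))
      · rw [if_pos hU, if_pos hU]; exact unitInterval.le_one'
      · rw [if_neg hU]
  · rw [restrW_apply_of_not_mem _ he]
    exact unitInterval.nonneg'

/-- **Row 5 of the record discharged: `KNFreeOriginLook d q p` holds for every `q ≥ 1`** (and every `d`, `p`): KN's
(32) at the origin follows from ONE free look of the aspect-`6` elongated geometry at scale `3r` — the tree's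
`KSch.hQ0_of_hit` with the law swapped (Λ-independence + monotonicity in the weighting + `U₀` open a.s. + the tree's
event inclusion). [cite: KozmaNitzan2024, §4 p. 28 ((32) for w = 0); Grimmett2006, eq. (3.22), Thm. (3.7)] -/
theorem knFreeOriginLook {q : ℝ} (hq : 1 ≤ q) (p : unitInterval) : KNFreeOriginLook d q p := by
  intro S _ du hlook
  have hq0 : 0 < q := one_pos.trans_le hq
  set g := elongGeom (S.C.axOf du) (σu du) 6 (by norm_num) with hg
  have hσ := sgOf_sign du
  have hr1 : (1 : ℤ) ≤ S.C.r := by exact_mod_cast S.C.r_pos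
  -- geometry (verbatim from the tree's `KSch.hQ0_of_hit`)
  have hQset : g.Qset (3 * S.C.r) 0 ⊆ S.C.Q 0 ∪ S.C.Ewv 0 du := by
    intro y hy
    have hy' : y ∈ S.C.bigD 0 du := by
      rw [hg, elongGeom_Qset_eq, σu_val] at hy
      rw [Cells.bigD, S.C.cen_zero]
      refine sBox_mono hσ 0 ?_ ?_ ?_ hy <;> push_cast <;> linarith
    rcases S.C.mem_Q_or_Efar_of_mem_bigD hy' with h | h
    · exact Finset.mem_union_left _ h
    · exact Finset.mem_union_right _ (S.C.Efar_subset_Ewv _ _ h)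
  have hFset : g.Fset (3 * S.C.r) 0 ⊆ S.C.M ((0 : Site 2) + stepVec du) := by
    intro y hy
    rw [hg, elongGeom_Fset_eq, σu_val, mem_sBox_iff hσ] at hy
    obtain ⟨⟨h1, h2⟩, ht⟩ := hy
    push_cast at h1 h2 ht
    rw [Cells.M, mem_cIcc_iff]
    intro i
    rw [S.C.cen_add_stepVec, S.C.cen_zero]
    push_cast
    by_cases hi : i = S.C.axOf du
    · subst hi
      rw [if_pos rfl]
      have hsq := sign_mul_self hσ
      have hb : -(3 * (S.C.r : ℤ)) ≤ sgOf du * (y (S.C.axOf du) - ((0 : Site d) (S.C.axOf du) + 20 * S.C.r * sgOf du)) ∧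
          sgOf du * (y (S.C.axOf du) - ((0 : Site d) (S.C.axOf du) + 20 * S.C.r * sgOf du)) ≤ 3 * S.C.r := by
        have e1 : sgOf du * (y (S.C.axOf du) - ((0 : Site d) (S.C.axOf du) + 20 * S.C.r * sgOf du)) =
            sgOf du * (y (S.C.axOf du) - (0 : Site d) (S.C.axOf du)) - 20 * S.C.r * (sgOf du * sgOf du) := by ring
        rw [e1, hsq]
        constructor <;> linarith
      have := abs_bounds_of_level hσ hb.1 hb.2
      constructor <;> linarith [this.1, this.2]
    · rw [if_neg hi]
      have := ht i hi
      simp only [Pi.zero_apply] at this ⊢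
      constructor <;> linarith [this.1, this.2]
  have hbox : box d (3 * S.C.r) ⊆ S.C.Q 0 := by
    intro y hy
    rw [mem_box] at hy
    rw [Cells.Q, S.C.cen_zero, mem_cIcc_iff]
    intro i; have := hy i; simp only [Pi.zero_apply]; push_cast at this ⊢; constructor <;> linarith [this.1, this.2]
  have hball : GM.ball (0 : Site d) (3 * S.C.r) ⊆ S.C.Q 0 := by rw [ball_zero_eq_box]; exact hbox
  have h0Q : (0 : Site d) ∈ S.C.Q 0 := by
    rw [Cells.Q, ← S.C.cen_zero]; exact center_mem_cIcc _ _
  -- the laws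
  set Λ : Finset (Site d) := S.C.Q 0 ∪ S.C.Ewv 0 du with hΛ
  set W : Sym2 (Site d) → unitInterval := restrW (↑Λ : Set (Site d)) (pinW (lattW d S.p) ↑S.U₀ ↑S.U₀) with hW
  set E1 := linkIn (↑(g.Qset (3 * S.C.r) 0) : Set (Site d)) (GM.ball 0 (3 * S.C.r)) (g.Fset (3 * S.C.r) 0) with hE1
  have hE1up : IsUpperSet E1 := by
    rw [hE1, linkIn_eq_biUnion]
    exact isUpperSet_iUnion₂ fun s _ => isUpperSet_iUnion₂ fun t _ => isUpperSet_openConnIn _ s t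
  have hE1m : MeasurableSet E1 := measurableSet_linkIn _ _ _
  -- (ii) Λ-independence: the free look read on `Q_0 ∪ E_{0,v}`
  have hfs : FinSupp (hitW S.p g (3 * S.C.r) (3 * S.C.r) 0) (g.Qset (3 * S.C.r) 0) := by
    unfold hitW; exact finSupp_restrW _ _
  have h1 : (fkLaw (g.Qset (3 * S.C.r) 0) (hitW S.p g (3 * S.C.r) (3 * S.C.r) 0) q).real E1 =
      (fkLaw Λ (hitW S.p g (3 * S.C.r) (3 * S.C.r) 0) q).real E1 := by
    rw [fkLaw_eq_of_subset hQset hfs hq0]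
  -- (iii) monotonicity in the weighting
  have h2 : (fkLaw Λ (hitW S.p g (3 * S.C.r) (3 * S.C.r) 0) q).real E1 ≤ (fkLaw Λ W q).real E1 :=
    fkLaw_real_mono_weights' Λ (hitW_le_originW S hQset hball g (3 * S.C.r) rfl) hq hE1up hE1m
  -- (iv) `U₀` is open almost surely under the pinned law
  have hU₀Λ : ∀ e ∈ (↑S.U₀ : Set (Sym2 (Site d))), ∀ x ∈ e, x ∈ Λ := by
    intro e he x hx
    rw [Finset.mem_coe, KSch.U₀, mem_edgesIn_iff] at he
    exact Finset.mem_union_left _ (he.2 x hx)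
  have hU₀W : ∀ e ∈ (↑S.U₀ : Set (Sym2 (Site d))), W e = 1 := by
    intro e he
    have hew : e ∈ wireSet (↑Λ : Set (Site d)) := by
      refine ⟨fun x hx => Finset.mem_coe.2 (hU₀Λ e he x hx), ?_⟩
      rw [Finset.mem_coe, KSch.U₀, mem_edgesIn_iff] at he
      exact SimpleGraph.not_isDiag_of_mem_edgeSet _ he.1
    rw [hW, restrW_apply_of_mem _ hew, pinW_apply_of_mem_of_mem _ he he]
  have h3 : (fkLaw Λ W q).real E1 = (fkLaw Λ W q).real (E1 ∩ {ω | (↑S.U₀ : Set (Sym2 (Site d))) ⊆ ω}) :=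
    (fkLaw_real_inter_setOf_subset_eq Λ hq0 S.U₀.countable_toSet hU₀Λ hU₀W hE1m).symm
  -- (v) the event inclusion (verbatim from the tree)
  have h4 : E1 ∩ {ω | (↑S.U₀ : Set (Sym2 (Site d))) ⊆ ω} ⊆
      ⋃ t ∈ (↑(S.C.M ((0 : Site 2) + stepVec du)) : Set (Site d)),
        openConnIn (↑(S.C.Q 0 ∪ S.C.Ewv 0 du) : Set (Site d)) 0 t := by
    rintro η ⟨hη, hU⟩
    obtain ⟨s, hs, t, ht, hst⟩ := mem_linkIn_iff.1 hη
    rw [ball_zero_eq_box] at hs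
    simp only [Set.mem_iUnion, exists_prop]
    refine ⟨t, Finset.mem_coe.2 (hFset ht), ?_⟩
    have hU₀open : ∀ x ∈ S.U₀, x ∈ η := fun x hx => hU (Finset.mem_coe.2 hx)
    have h0s : η ∈ openConnIn (↑(S.C.Q 0 ∪ S.C.Ewv 0 du) : Set (Site d)) 0 s := by
      rw [mem_openConnIn_iff_pathIn]
      have hp := exists_pathIn_Icc h0Q (hbox hs)
      refine (DCT16.pathIn_congrGraph (fun x y hx hy hxy => ?_) hp).mono (Finset.coe_subset.2 Finset.subset_union_left)
      rw [openGraph_adj]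
      refine ⟨hU₀open _ ?_, hxy.ne⟩
      rw [KSch.U₀, mem_edgesIn_iff]
      refine ⟨(SimpleGraph.mem_edgeSet _).2 hxy, fun z hz => ?_⟩
      rcases Sym2.mem_iff.1 hz with rfl | rfl
      · exact Finset.mem_coe.1 hx
      · exact Finset.mem_coe.1 hy
    have hst' : η ∈ openConnIn (↑(S.C.Q 0 ∪ S.C.Ewv 0 du) : Set (Site d)) s t := by
      rw [mem_openConnIn_iff_pathIn] at hst ⊢
      exact hst.mono (Finset.coe_subset.2 hQset)
    exact SlabCriticality.openConnIn_trans h0s hst'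
  haveI := isProbabilityMeasure_fkLaw Λ W hq0
  calc 1 - S.δc < (fkLaw (g.Qset (3 * S.C.r) 0) (hitW S.p g (3 * S.C.r) (3 * S.C.r) 0) q).real E1 := hlook
    _ = _ := h1
    _ ≤ _ := h2
    _ = _ := h3
    _ ≤ _ := measureReal_mono h4 (measure_ne_top _ _)

end Summit.CriticalPhenomena.PercolationContinuityZ3.Theorems.FK

end
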